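import Summits.CriticalPhenomena.SAWScalingLimit.Theses.SAWLoopFugacityFlow
import Summits.CriticalPhenomena.SAWScalingLimit.Theses.SAWParafermion
import Literature.Probability.RandomPlanarGeometry.LoewnerDescription
import Summits.CriticalPhenomena.SAWScalingLimit.Theorems.SAWLoopFugacityFlowSimpleSubseqLimitsStubRangeIsArcCC
import Summits.CriticalPhenomena.SAWScalingLimit.Theorems.SAWLoopFugacityFlowSimpleSubseqLimitsStubArcClock
import Summits.CriticalPhenomena.SAWScalingLimit.Theorems.SAWLoopFugacityFlowSimpleSubseqLimitsStubDescribable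
import Literature.Probability.RandomPlanarGeometry.LoewnerRegularBoxes

/-!
# Line `capacity-clock-no-plateau` — skeleton for the crux `SimpleSubseqLimits`
(stmt-CriticalPhenomena-4982; decl
`Summit.CriticalPhenomena.SAWScalingLimit.Theses.SAWLoopFugacityFlow.SimpleSubseqLimits`, shared
verbatim by the routes SAWSteinDefect / SAWTensorRG / SAWFrontierHomotopy).

Crux-plan of the merged clock ideas (capacity-clock-no-plateau ≈ arc-range-loewner-clock ≈
capacity-clock, triage r1-1/2/3): SHAPE from the route's avoidance values at the SET level,
ORDER from Kemppainen–Smirnov describability, glued by the deterministic ARC CLOCK lemma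
(a Loewner-describable class whose range is a simple chord is simple: the half-plane capacity
clock `hcap = 2t` cannot stall, and a backtrack along an arc is a stall).

Inputs taken BY NAME as hypotheses of the composition (registered route items, not stubs):
`AvoidanceLimit` (stmt-10649, rank 2), `SLEAvoidanceValue` (stmt-10651), `AvoidancePassage`
(stmt-4984) of SAWLoopFugacityFlow, and `SAWParafermion.KSAdmissibleG1` (stmt-11346).
`SLECarrier` is not needed as a hypothesis: its content is the landed theorem
`Negative.ae_carrier_of_isSLELaw` (Theorems/SimpleSubseqLimits/Negative/SimpleSubseqLimitsNecessary).
The endpoint/confinement clauses are carried inside the stubs (they are also the free clauses of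
the landed `Negative.simpleSubseqLimits_iff_core`, Disproof §5, which a prover may import instead).

Stubs (4): `stub_rangeIsArc` (SHAPE, M–L), `stub_arcClock` (the lever, deterministic, M,
provable now), `stub_describable_of_G1` (ORDER for tame data = the SAW instance of KS 2017
Prop. 3.2 / Thms 3.9–3.10 / Thm 1.5 (ii), L), `stub_tameReduction` (the endpoint/discretisation
gap named by triage F2/F4/S2, L, partly open). Composition `SimpleSubseqLimits_of` is sorry-free.
-/

noncomputable section

open MeasureTheory Filter Topology Set
open Literature.Probability.RandomPlanarGeometry Literature.Probability.LatticeModels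
open UpperHalfPlane (upperHalfPlaneSet)
open scoped ENNReal NNReal
open Summit.CriticalPhenomena.SAWScalingLimit.Theses.SAWLoopFugacityFlow
  (SimpleSubseqLimits AvoidanceLimit SLEAvoidanceValue AvoidancePassage)
open Summit.CriticalPhenomena.SAWScalingLimit.Theses.SAWParafermion (KSAdmissibleG1)

namespace Summit.CriticalPhenomena.SAWScalingLimit.Cruxes.SimpleSubseqLimits.CapacityClockNoPlateau

/-! ## Vocabulary (abbreviations of the crux's own hypotheses; no new mathematics) -/

/-- `ν` is a probability measure on curve classes that is the weak limit, along `s n → 0⁺`, of the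
pushed-forward critical `δℤ²` SAW laws of `(D; a_δ, b_δ)` — the three antecedents of the crux,
verbatim. -/
def IsSubseqLimit (D : DobrushinDomain) (a b : ℝ → Site 2) (s : ℕ → ℝ)
    (ν : Measure (CurveClass ℂ)) : Prop :=
  Tendsto s atTop (𝓝[>] (0 : ℝ)) ∧ IsProbabilityMeasure ν ∧
    ∀ f : BoundedContinuousFunction (CurveClass ℂ) ℝ,
      Tendsto (fun n => ∫ γ, f γ.curve ∂(SAW.law D.carrier (s n) (a (s n)) (b (s n)))) atTop
        (𝓝 (∫ x, f x ∂ν))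

/-- The conclusion of the crux at one `(D; a, b)`: every subsequential weak limit is carried by
simple classes from `a` to `b` in `cl D` meeting `∂D` only at `a, b` (the carrier clause of
`AvoidanceDeterminesLaw`, verbatim). By Disproof §5 (landed `Negative.simpleSubseqLimits_iff_core`)
only the first and last clauses are genuine; the others are kept so that the crux is met verbatim. -/
def CarrierAt (D : DobrushinDomain) (a b : ℝ → Site 2) : Prop :=
  ∀ (s : ℕ → ℝ) (ν : Measure (CurveClass ℂ)), IsSubseqLimit D a b s ν →
    ∀ᵐ c ∂ν, c ∈ CurveClass.simple ∧ c.source = D.pt 0 ∧ c.target = D.pt 1 ∧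
      c.range ⊆ closure D.carrier ∧ c.range ∩ frontier D.carrier ⊆ {D.pt 0, D.pt 1}

/-- **Tame (admissibly discretised, boundary-rooted) data** — the regime in which the conditional
laws of the critical SAW of `Ω_δ` given any initial segment are EXACTLY members of the admissible
cell-domain family of `KSAdmissibleG1` (Kemppainen–Smirnov §4.1.6; triage F1/F4 conventions):
eventually along `δ → 0⁺`, (i) `Ω_δ = discreteDomainGraph D δ` is the subgraph of `ℤ²` INDUCED on
`meshDomain D δ` (no edge removed by the closed-segment rule), (ii) the lattice complement of
`meshDomain D δ` is connected (the polyomino is simply connected), (iii) `a δ` and `b δ` are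
BOUNDARY VERTICES (a `ℤ²`-neighbour outside `meshDomain`). Holds e.g. for every `C²` Jordan domain
with nearest-site endpoint approximations; fails for interior (mesoscopic-depth) roots and for
boundaries with sub-mesh structure at all scales (triage F2, S2). -/
def IsTame (D : DobrushinDomain) (a b : ℝ → Site 2) : Prop :=
  ∀ᶠ δ in 𝓝[>] (0 : ℝ),
    (∀ x y : Site 2, (discreteDomainGraph D.carrier δ).Adj x y ↔
        ((zdGraph 2).Adj x y ∧ x ∈ meshDomain D.carrier δ ∧ y ∈ meshDomain D.carrier δ)) ∧
    ((zdGraph 2).induce (meshDomain D.carrier δ)ᶜ).Preconnected ∧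
    (∃ w ∉ meshDomain D.carrier δ, (zdGraph 2).Adj (a δ) w) ∧
    (∃ w ∉ meshDomain D.carrier δ, (zdGraph 2).Adj (b δ) w)

/-- The plain **square-cell domain** `U(S, δ)` of a finite vertex set `S ⊆ ℤ²` at mesh `δ`: the
interior of the union of the closed `δ`-squares centred at the mesh points of `S` — VERBATIM the
inline domain of `SAWParafermion.KSAdmissibleG1` (stmt-11346; Kemppainen–Smirnov §4.1.6). Its
discretisation `discreteDomainGraph (cellDomain S δ) δ` is the subgraph of `ℤ²` induced on `S`
when `S` is connected. -/
def cellDomain (S : Finset (Site 2)) (δ : ℝ) : Set ℂ :=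
  interior (⋃ v ∈ S, {z : ℂ | |z.re - (meshPoint δ v).re| ≤ δ / 2 ∧ |z.im - (meshPoint δ v).im| ≤ δ / 2})

open scoped Classical in
/-- The **remaining vertex set** after an explored prefix: the vertices of `S` joined to the tip
`t` by a lattice path inside `S` avoiding the deleted set `P` (Kemppainen–Smirnov §4.1.6:
`U_t = {tip} ∪ comp_b`; dead pockets cut off by the prefix are discarded, which does not change
the law of the future). -/
def remainingVerts (S P : Finset (Site 2)) (t : Site 2) : Finset (Site 2) :=
  S.filter fun w => ∃ q : (zdGraph 2).Walk t w, ∀ x ∈ q.support, x ∈ S ∧ x ∉ P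

/-- **Exact domain Markov property of the critical SAW law on cell domains** (the configurational
`x_c`-weights factorise: Madras–Slade §1.2; LSW04 §3.4.5; KS §4.1.6 "at time `t` the domain `U_t`
is admissible"): for a connected vertex set `S`, a prefix `p = [p₀, …, p_k]` with last vertex `t`
and a Borel set `B` of curve classes, the law of the SAW of `U(S, δ)` from `a` to `b` restricted
to {prefix = `p`, class of the REMAINING polyline ∈ `B`} factorises as P{prefix = `p`} times the
pushed-forward SAW law of the remaining cell domain `U(S'', δ)` from `t` to `b`, where
`S'' = remainingVerts S {p₀,…,p_{k-1}} t`. Degenerate data (invalid prefix, `a ∉ S`, no walk)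
make both sides `0`. -/
def SAWDomainMarkov : Prop :=
  ∀ (S : Finset (Site 2)) (δ : ℝ) (a b : Site 2) (p : List (Site 2)) (t : Site 2), 0 < δ →
    ((zdGraph 2).induce (↑S : Set (Site 2))).Preconnected → p ≠ [] → p.getLast? = some t →
    ∀ B : Set (CurveClass ℂ), MeasurableSet B →
      SAW.law (cellDomain S δ) δ a b
          {γ | γ.walk.support.take p.length = p ∧
            CurveClass.mk ⟨(γ.walk.drop (p.length - 1)).toCurve (meshPoint δ)⟩ ∈ B} =
        SAW.law (cellDomain S δ) δ a b {γ | γ.walk.support.take p.length = p} *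
          (SAW.law (cellDomain (remainingVerts S (p.dropLast).toFinset t) δ) δ t b).map
            (fun γ => γ.curve) B

/-- **KS regularity of the critical SAW along a sequence of meshes, through approximating maps**
(sequence form of `IsKSRegularAlongMesh`, ALL indices): approximating Dobrushin domains `D_n` with
chordal uniformizing maps `φ_n` whose boundary extensions converge to that of `φ` uniformly on the
compacts `{0 ≤ im} ∩ closedBall 0 R` ((U1)) and uniformly at infinity ((U2)), `b_n → b`, and for
every `ε > 0` ONE regularity `𝔯` (`LoewnerRegularCurves.lean`: KS's event `E ∩ X_simple`) with
`P_{s n}[curve ∉ regularCurves (φ_n) 𝔯] ≤ ε` for ALL `n` — literally the hypotheses of the tree's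
`ae_isLoewnerDescribable_and_tendstoInDistribution_of_regularCurves_varying` (KS Thm. 1.5 (ii),
deterministic half, PROVED) for the laws `(SAW.law D (s n) (a (s n)) (b (s n))).map curve`. -/
def SAWKSRegularAlong (D : DobrushinDomain) (a b : ℝ → Site 2)
    (φ : ConformalEquiv upperHalfPlaneSet D.carrier) (s : ℕ → ℝ) : Prop :=
  ∃ (Ds : ℕ → DobrushinDomain) (φs : ∀ n, ConformalEquiv upperHalfPlaneSet (Ds n).carrier),
    (∀ n, (Ds n).IsChordalUniformizing (φs n)) ∧
    (∀ R : ℝ, TendstoUniformlyOn (fun n => (φs n).boundaryExtension) φ.boundaryExtension atTop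
      ({z : ℂ | 0 ≤ z.im} ∩ Metric.closedBall 0 R)) ∧
    (∀ ε : ℝ, 0 < ε → ∃ r : ℝ, ∀ᶠ n in atTop, ∀ z : ℂ, z ∈ {z : ℂ | 0 ≤ z.im} → r ≤ ‖z‖ →
      dist ((φs n).boundaryExtension z) ((Ds n).pt 1) ≤ ε) ∧
    Tendsto (fun n => (Ds n).pt 1) atTop (𝓝 (D.pt 1)) ∧
    ∀ ε : ℝ≥0∞, 0 < ε → ∃ 𝔯 : LoewnerRegularity, ∀ n,
      SAW.law D.carrier (s n) (a (s n)) (b (s n)) {γ | γ.curve ∈ (regularCurves (φs n) 𝔯)ᶜ} ≤ ε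

/-- **Kemppainen–Smirnov regularity of the critical SAW, for tame data** (the ORDER content of the
crux in KS's form): for tame `(D; a_δ, b_δ)`, every chordal uniformizing map `φ` and every sequence
of meshes `s n → 0⁺` along which the SAW laws are honest probability measures, the pushed-forward
SAW laws are KS-regular along the sequence through approximating domains and maps
(`SAWKSRegularAlong`: the OUTPUT of KS Prop. 3.2 / Thms. 3.9–3.10 from Condition G2 — uniform over
the whole family, hence for all indices — here to be fed by `KSAdmissibleG1` + `SAWDomainMarkov`
in KS's lattice (cell-domain) convention, §4.1.6). -/
def SAWKSRegular : Prop :=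
  ∀ (D : DobrushinDomain) (a b : ℝ → Site 2), SAW.IsEndpointApprox D a b → IsTame D a b →
    ∀ (φ : ConformalEquiv upperHalfPlaneSet D.carrier), D.IsChordalUniformizing φ →
      ∀ s : ℕ → ℝ, Tendsto s atTop (𝓝[>] (0 : ℝ)) →
        (∀ n, IsProbabilityMeasure (SAW.law D.carrier (s n) (a (s n)) (b (s n)))) →
        SAWKSRegularAlong D a b φ s

/-! ## The registered stubs (six) -/

/-- **STUB 1 — SHAPE (range is the SLE_(8/3) arc), M–L.** Under the route's avoidance items, for
every subsequential weak limit `ν`, `ν`-a.e. class `c` has the RANGE of a simple chord `c'` of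
`(D; a, b)` lying in `cl D` and meeting `∂D` only at `a, b`.
Plan (triage S1/F5, checked on paper by all three triagers): the SLE_(8/3) law `μ` of `D` exists
(`exists_isSLECurve_eightThirds`) and is carried by simple boundary-avoiding chords
(`Negative.ae_carrier_of_isSLELaw`, landed); `AvoidanceLimit` + `SLEAvoidanceValue` (restriction
data of pulled-back hulls: `IsStarHull.pullbackHull`, `existsUnique_isRestrictionMap_holds`) feed
`AvoidancePassage`, so `ν(range ⊆ cl D') = μ(range ⊆ cl D')` for every hull subdomain `D'`;
FIRST the boundary clause from thin hulls over boundary segments (values → 1,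
`LSWConverges.tendsto_restrictionDeriv`), THEN exhaustion `{K ∩ C = ∅} = ⋃ₙ {K ⊆ cl D'ₙ}` for
boundary-attached compacta `C` (Jordan–Schoenflies), so the Choquet/π-system data of the two-sided
fill `M* = cl D ∖ (U_L ∪ U_R)` agree under `ν` and `μ`; `law_ν(M*) = law_μ(range)` = law of a
simple arc from `a` to `b`; a connected `range ∋ a, b` inside that arc is the arc. Uses both
endpoint limits of `IsEndpointApprox` (Disproof §2 `_false_without_tendsto_fst/snd` honoured here)
and criticality only through `AvoidanceLimit` (Disproof §9). -/
theorem stub_rangeIsArc :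
    AvoidanceLimit → SLEAvoidanceValue → AvoidancePassage →
    ∀ (D : DobrushinDomain) (a b : ℝ → Site 2), SAW.IsEndpointApprox D a b →
      ∀ (s : ℕ → ℝ) (ν : Measure (CurveClass ℂ)), IsSubseqLimit D a b s ν →
        ∀ᵐ c ∂ν, ∃ c' ∈ CurveClass.simple, c'.source = D.pt 0 ∧ c'.target = D.pt 1 ∧
          c'.range ⊆ closure D.carrier ∧ c'.range ∩ frontier D.carrier ⊆ {D.pt 0, D.pt 1} ∧
          c'.range = c.range := by
  exact Summit.CriticalPhenomena.SAWScalingLimit.Theorems.SimpleSubseqLimits.CapacityClock.RangeIsArc.stub_rangeIsArc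

/-- **STUB 2 — the ARC CLOCK (the lever; deterministic, M, provable now from the Loewner API).**
A curve class described by the Loewner evolution through a chordal uniformizing map `φ` of
`(D; a, b)` whose range is the range of a SIMPLE chord `c'` from `a` to `b` in `cl D` meeting `∂D`
only at `a, b` is itself simple, and runs from `a` to `b`.
Proof (triage r1-3): `c = mk c''`, `c''` the compactified `φ.boundaryExtension`-image of the
generating curve `γ` of a chain with continuous `W` (`IsLoewnerDescribed`); `φ.bE (W 0) ∈ ∂D ∩
range = {a, b}` and `≠ b` forces `W 0 = 0`, `c'' 0 = a`; with the arc coordinate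
`h = J⁻¹ ∘ c''` (`J` an injective representative of `c'`, `IsSimple.homeomorphRange`),
`γ[0, t] = φ⁻¹ (J (0, M t])  ∪ {0}` with `M` the running max of `h`, so the hull `K_t` is a
function of `M t` alone; `hcap K_t = 2t` strictly increasing (`hcap_hpFill_image_Icc_mono`,
`hcap_hpFill_image_Icc_lt_of_exit`) forces `h` strictly increasing, hence `c''` injective and
`c ∈ CurveClass.simple` (`CurveClass.mk_mem_simple`); `c.source = φ.bE 0 = a`
(`IsChordalUniformizing`), `c.target = c'' 1 = b` (`IsCompactifiedImage`). Kemppainen–Smirnov,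
arXiv:1212.6215, Thm 1.3 bullet 4 / journal Thm 1.5: "for any parametrisation the capacity is
strictly increasing". -/
theorem stub_arcClock (D : DobrushinDomain) (φ : ConformalEquiv upperHalfPlaneSet D.carrier)
    (hφ : D.IsChordalUniformizing φ) (c c' : CurveClass ℂ) (hc : IsLoewnerDescribable φ c)
    (hc' : c' ∈ CurveClass.simple) (h0 : c'.source = D.pt 0) (h1 : c'.target = D.pt 1)
    (hcl : c'.range ⊆ closure D.carrier)
    (hfr : c'.range ∩ frontier D.carrier ⊆ {D.pt 0, D.pt 1}) (hrange : c.range = c'.range) :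
    c ∈ CurveClass.simple ∧ c.source = D.pt 0 ∧ c.target = D.pt 1 := by
  exact Summit.CriticalPhenomena.SAWScalingLimit.Theorems.SimpleSubseqLimits.CapacityClock.ArcClock.stub_arcClock D φ hφ
    c c' hc hc' h0 h1 hcl hfr hrange

/-- **STUB 3a — describability from KS regularity (M, provable now).** If along every honest
sequence of meshes the pushed-forward SAW laws of `(D; a_δ, b_δ)` are KS-regular through
approximating maps converging to `φ` (`SAWKSRegularAlong`), then every subsequential weak limit
`ν` is `ν`-a.e. described by the Loewner evolution through `φ` — the tree's PROVED deterministic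
half of KS Thm. 1.5 (ii), `ae_isLoewnerDescribable_and_tendstoInDistribution_of_regularCurves_varying`,
applied to the honest tail `n ↦ s (n + N₀)` of the given sequence (laws honest eventually:
`Negative.eventually_isProbabilityMeasure_of_weakLimitAlong`; the weak limit of a tail is still `ν`;
`∫ f ∂(map curve P) = ∫ f ∘ curve ∂P`; the possibly non-measurable complement of `regularCurves`
is handled through the countable type of lattice walks). -/
theorem stub_describable_of_ksRegular :
    ∀ (D : DobrushinDomain) (a b : ℝ → Site 2), SAW.IsEndpointApprox D a b →
      ∀ (φ : ConformalEquiv upperHalfPlaneSet D.carrier), D.IsChordalUniformizing φ →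
        (∀ s : ℕ → ℝ, Tendsto s atTop (𝓝[>] (0 : ℝ)) →
          (∀ n, IsProbabilityMeasure (SAW.law D.carrier (s n) (a (s n)) (b (s n)))) →
          SAWKSRegularAlong D a b φ s) →
        ∀ (s : ℕ → ℝ) (ν : Measure (CurveClass ℂ)), IsSubseqLimit D a b s ν →
          ∀ᵐ c ∂ν, IsLoewnerDescribable φ c := by
  exact Summit.CriticalPhenomena.SAWScalingLimit.Theorems.SimpleSubseqLimits.CapacityClock.Describable.stub_describable_of_ksRegular

/-- **STUB 3c — the exact domain Markov property of the critical SAW on cell domains (M–L,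
provable now; lattice combinatorics + finite sums).** See `SAWDomainMarkov`. -/
theorem stub_sawDomainMarkov : SAWDomainMarkov := by
  sorry

/-- **STUB 3b — KS regularity of the tame critical SAW from Condition G1 (L–XL; the probabilistic
half of Kemppainen–Smirnov for the SAW).** Under `KSAdmissibleG1` (stmt-11346: time-zero G1, one
constant, for critical SAW on admissible cell domains between boundary vertices) and the exact
domain Markov property, for TAME data the pushed-forward SAW laws are KS-regular along the mesh
(`SAWKSRegular`). Plan: (a) under `IsTame`, `discreteDomainGraph D δ` is the subgraph of `ℤ²`
induced on `S_δ = meshDomain D δ`, so `SAW.law D δ = SAW.law (cellDomain S_δ δ) δ` after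
push-forward, and by `SAWDomainMarkov` the conditional law of the future given any prefix is the
SAW law of an ADMISSIBLE remaining cell domain between boundary vertices — so `KSAdmissibleG1` IS
Condition G2 for this family in KS's cell convention (§4.1.6; NOT the tree's polyline-slit
`ConditionG2`, which fails for SAW polylines: lattice-sealed pockets with continuum `δ/2`-gaps);
(b) the approximating Dobrushin domains are the cell polygons of `S_δ` with corner wedges at the
two roots (Jordan: an admissible polyomino has no diagonal pinch), converging to `D` in kernel
sense with (B), (K1), (K2), (ULC), `a_δ → a`, `b_δ → b`, whence uniformizing maps `φ_δ → φ` with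
(U1), (U2) (`MarkedDomain.exists_uniformizers_of_kernel_of_isChordalUniformizing`); (c) KS Prop. 3.2,
Thms. 3.9–3.10 (the probabilistic half, to be formalised in the lattice convention — the analogue of
the named fact `exists_regularity_of_conditionG2`) give ONE regularity `𝔯` per `ε`. -/
theorem stub_ksRegular_of_G1 : KSAdmissibleG1 → SAWDomainMarkov → SAWKSRegular := by
  sorry

/-- **ORDER for tame data** (the former stub 3, now a theorem of stubs 3a–3c): under
`KSAdmissibleG1`, for tame data every subsequential weak limit is `ν`-a.e. Loewner-describable
through every chordal uniformizing map. -/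
theorem stub_describable_of_G1 :
    KSAdmissibleG1 →
    ∀ (D : DobrushinDomain) (a b : ℝ → Site 2), SAW.IsEndpointApprox D a b → IsTame D a b →
      ∀ (s : ℕ → ℝ) (ν : Measure (CurveClass ℂ)), IsSubseqLimit D a b s ν →
        ∀ (φ : ConformalEquiv upperHalfPlaneSet D.carrier), D.IsChordalUniformizing φ →
          ∀ᵐ c ∂ν, IsLoewnerDescribable φ c :=
  fun hG D a b hab hT s ν hsub φ hφ =>
    stub_describable_of_ksRegular D a b hab φ hφ
      (stub_ksRegular_of_G1 hG stub_sawDomainMarkov D a b hab hT φ hφ) s ν hsub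

/-- **STUB 4 — TAME REDUCTION (the endpoint/discretisation gap of triage F2/F4/S2; L, partly
open).** If the conclusion of the crux holds for all TAME data, it holds for all Dobrushin
domains and all endpoint approximations.
What is known / planned: (1) DOMAIN PART, away from the marked points (M, uses `AvoidanceLimit`):
for a hull subdomain `D' ⊆ D` agreeing with `D` near `a, b`, generic for the countably many
lattices `s n · ℤ²`, the walks of `Ω_δ` with trace in `cl D'` are exactly the walks of `Ω'_δ`, so
`law_D(· ∣ range ⊆ cl D') = law_{D'}` and `‖law_D − law_{D'}‖_TV ≤ 2(1 − P_D(range ⊆ cl D'))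
→ 2(1 − Φ'_A(0)^{5/8})` (`AvoidanceLimit`), which is small for `D'` close to `D`
(`LSWConverges.tendsto_restrictionDeriv`); subsequential limits of `law_{D'}` exist along a
subsequence (domination ⇒ tightness, Prokhorov on the Polish `CurveClass ℂ`) and the carrier
clause transfers because `cl D' ⊆ cl D` and `cl D' ∩ ∂D ⊆ ∂D'`. (2) ENDPOINT PART (open): roots at mesoscopic depth
(`IsEndpointApprox` only asks `δ·a_δ → a`) and boundaries that are not lattice-tame AT `a` or `b`
— insensitivity of subsequential limits to the microscopic endpoint data (Kennedy–Lawler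
arXiv:1109.3091 lattice effects cancel in the normalised law; reversal `law(D;a,b) = rev law(D;b,a)`
handles one tame end). This is the common residue of every G-fed line on this crux. -/
theorem stub_tameReduction :
    AvoidanceLimit →
    (∀ (D : DobrushinDomain) (a b : ℝ → Site 2), SAW.IsEndpointApprox D a b → IsTame D a b →
      CarrierAt D a b) →
    ∀ (D : DobrushinDomain) (a b : ℝ → Site 2), SAW.IsEndpointApprox D a b → CarrierAt D a b := by
  sorry

/-! ## Kernel-checked glue -/

/-- SHAPE + ORDER + the arc clock give the conclusion of the crux on tame data (sorry-free modulo
the stubs it invokes). -/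
theorem carrierAt_of_isTame (hA : AvoidanceLimit) (hV : SLEAvoidanceValue) (hP : AvoidancePassage)
    (hG : KSAdmissibleG1) (D : DobrushinDomain) (a b : ℝ → Site 2)
    (hab : SAW.IsEndpointApprox D a b) (hT : IsTame D a b) : CarrierAt D a b := by
  intro s ν hsub
  obtain ⟨φ, hφ⟩ := MarkedDomain.exists_isChordalUniformizing_holds D
  filter_upwards [stub_rangeIsArc hA hV hP D a b hab s ν hsub,
    stub_describable_of_G1 hG D a b hab hT s ν hsub φ hφ] with c hc hd
  obtain ⟨c', hc's, h0, h1, hcl, hfr, hrange⟩ := hc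
  obtain ⟨hsimple, hsrc, htgt⟩ := stub_arcClock D φ hφ c c' hd hc's h0 h1 hcl hfr hrange.symm
  exact ⟨hsimple, hsrc, htgt, hrange ▸ hcl, hrange ▸ hfr⟩

/-- **COMPOSITION.** The crux `SimpleSubseqLimits` BY NAME, from the four stubs, under the route
items `AvoidanceLimit`, `SLEAvoidanceValue`, `AvoidancePassage` (SAWLoopFugacityFlow) and
`KSAdmissibleG1` (SAWParafermion) taken as named hypotheses. No `sorry` here. -/
theorem SimpleSubseqLimits_of (hA : AvoidanceLimit) (hV : SLEAvoidanceValue)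
    (hP : AvoidancePassage) (hG : KSAdmissibleG1) : SimpleSubseqLimits := by
  intro D a b hab s ν hs hν hw
  exact stub_tameReduction hA
    (fun D' a' b' hab' hT' => carrierAt_of_isTame hA hV hP hG D' a' b' hab' hT')
    D a b hab s ν ⟨hs, hν, hw⟩

end Summit.CriticalPhenomena.SAWScalingLimit.Cruxes.SimpleSubseqLimits.CapacityClockNoPlateau

end
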